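import Summits.QuantumFields.YangMills.Theorems.ColdStartUniversalityLatticeLangevinDossSussmannSmoothingThreeFlat
import Summits.QuantumFields.YangMills.Theorems.ColdStartUniversalityLatticeLangevinRegularFlow
import Summits.QuantumFields.YangMills.Theorems.ColdStartUniversalityLatticeLangevinFeller
import HarnessLib

/-!
# Route `ColdStartUniversality` (fixed-cut-off SZZ dynamics; Doss–Sussmann smoothing programme, file 15):
# THE SZZ TRANSITION KERNELS PRESERVE THE DYNKIN CLASS — kernel-language form

Helper file (seat `ym-line-csu-p1`, g24).  The consumable form of files 13–14, in the language of the tree's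
fixed-cut-off semigroup package (`continuous_integral_transitionKernel`, `chapmanKolmogorov_szz`, `exists_poisson_solution`,
…: ANY Markov kernel family `κ` realising the transition laws of the Shen–Zhu–Zhu dynamics on `SU(2)^E` at coupling `β'`):
★★★ `transitionKernel_preserves_dynkinClass` — for every `C³` function `f` of the real link coordinates and every lattice
time `t` there is a `C³`, COMPACTLY SUPPORTED `g` with `∫ f(coords y) κ_t(x, dy) = g(coords x)` for all `x ∈ SU(2)^E`,
`coords V q = Re/Im (V_{q.1})_{q.2.1 q.2.2.1}` — i.e. `κ_t` maps the test-function class of `dynkin_expectation_szz`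
(`ContDiff ℝ 3 ∧ HasCompactSupport`, composed with `coords`) into itself.  Proof: realise `κ_t(x, ·)` by the regular
solution flow on the product Wiener space (`exists_regularFlow` at couplings `β'` and `0`, same flat noise) and apply
`markovTransition_contDiff_three_flat`.
THEOREMS ONLY, no sorry.  HONEST FRAMING: fixed-cut-off regularity; nothing K-uniform; no crux, rung or summit statement
is proved; the Yang–Mills mass gap is NOT proved.
-/

set_option autoImplicit false

noncomputable section

namespace Summit.QuantumFields.YangMills.Theorems.ColdStartUniversality

open MeasureTheory ProbabilityTheory Finset Filter Set Metric Function
open scoped NNReal Matrix Topology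
open Literature.MathematicalPhysics.QuantumFieldTheory
open Literature.MathematicalPhysics.QuantumLattice (fundamentalRep fundamentalLatticeRep continuous_fundamentalRep
  fundamentalRep_mem_unitaryGroup)
open Literature.Probability.Process

variable {L : ℕ}

/-- The flat real coordinate map of `SU(2)^E` is continuous. [folklore] -/
theorem continuous_flatCoords [NeZero L] :
    Continuous fun (y : GaugeConfig 3 L (Matrix.specialUnitaryGroup (Fin 2) ℂ))
      (q : Edge 3 L × Fin 2 × Fin 2 × Bool) => (fun z : ℂ => if q.2.2.2 then z.im else z.re)
        ((fundamentalRep (Fin 2) (y q.1) : Matrix (Fin 2) (Fin 2) ℂ) q.2.1 q.2.2.1) := by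
  have h := (contDiff_toFlat (L := L) (n := 1)).continuous.comp (continuous_coordsRho (L := L))
  exact h

/-- ★★★ **The SZZ transition kernels preserve the Dynkin class.**  For ANY Markov kernel family `κ` realising the
transition laws of the SU(2) lattice Langevin (SZZ) dynamics at coupling `β'`, every lattice time `t` and every `C³`
function `f` of the real link coordinates, there is a `C³`, compactly supported `g` with
`∫ f(coords y) κ_t(x, dy) = g(coords x)` for all `x ∈ SU(2)^E`. [folklore] -/
theorem transitionKernel_preserves_dynkinClass (L : ℕ) [NeZero L] (β' : ℝ)
    (κ : ℝ≥0 → Kernel (GaugeConfig 3 L (Matrix.specialUnitaryGroup (Fin 2) ℂ))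
      (GaugeConfig 3 L (Matrix.specialUnitaryGroup (Fin 2) ℂ)))
    (hreal : ∀ (t : ℝ≥0) (x : GaugeConfig 3 L (Matrix.specialUnitaryGroup (Fin 2) ℂ))
        (Ω : Type) [MeasurableSpace Ω] (P : Measure Ω) [IsProbabilityMeasure P]
        (W : ℝ≥0 → Ω → (Edge 3 L × NoiseIdx 2 → ℝ)) (hW : IsFlatBrownian W P)
        (U : ℝ≥0 → Ω → GaugeConfig 3 L (Matrix.specialUnitaryGroup (Fin 2) ℂ)),
        (∀ ω, U 0 ω = x) →
        (latticeLangevinDynamics (fundamentalLatticeRep 2) β').IsSolution (fundamentalRep (Fin 2))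
          hW.natFiltration P W U →
        κ t x = P.map (U t))
    (t : ℝ≥0) {f : (Edge 3 L × Fin 2 × Fin 2 × Bool → ℝ) → ℝ} (hf : ContDiff ℝ 3 f) :
    ∃ g : (Edge 3 L × Fin 2 × Fin 2 × Bool → ℝ) → ℝ, ContDiff ℝ 3 g ∧ HasCompactSupport g ∧
      ∀ x : GaugeConfig 3 L (Matrix.specialUnitaryGroup (Fin 2) ℂ),
        ∫ y, f (fun q : Edge 3 L × Fin 2 × Fin 2 × Bool => (fun z : ℂ => if q.2.2.2 then z.im else z.re)
            ((fundamentalRep (Fin 2) (y q.1) : Matrix (Fin 2) (Fin 2) ℂ) q.2.1 q.2.2.1)) ∂(κ t x) =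
          g (fun q : Edge 3 L × Fin 2 × Fin 2 × Bool => (fun z : ℂ => if q.2.2.2 then z.im else z.re)
            ((fundamentalRep (Fin 2) (x q.1) : Matrix (Fin 2) (Fin 2) ℂ) q.2.1 q.2.2.1)) := by
  haveI := secondCountableTopology_su2
  haveI := borelSpace_config L
  haveI := isProbabilityMeasure_piWiener (Edge 3 L × NoiseIdx 2)
  have hWc := isFlatBrownian_piWiener 3 L (NoiseIdx 2)
  -- regular solution flows at couplings `β'` and `0` on the product Wiener space
  obtain ⟨U, -, hU, hUm, -⟩ := exists_regularFlow L β' hWc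
  obtain ⟨B, -, hB, hBm, -⟩ := exists_regularFlow L 0 hWc
  obtain ⟨g, hg, hgc, hgU⟩ := markovTransition_contDiff_three_flat (L := L) β' hWc B U hB hBm hU hUm t hf
  refine ⟨g, hg, hgc, fun x => ?_⟩
  have hm : Measurable (U x t) := ((hU x).2.adapted t).mono (hWc.natFiltration.le t) le_rfl
  have hfc : Continuous fun y : GaugeConfig 3 L (Matrix.specialUnitaryGroup (Fin 2) ℂ) =>
      f (fun q : Edge 3 L × Fin 2 × Fin 2 × Bool => (fun z : ℂ => if q.2.2.2 then z.im else z.re)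
        ((fundamentalRep (Fin 2) (y q.1) : Matrix (Fin 2) (Fin 2) ℂ) q.2.1 q.2.2.1)) :=
    hf.continuous.comp (continuous_flatCoords (L := L))
  rw [hreal t x _ (Measure.pi fun _ : Edge 3 L × NoiseIdx 2 => preWienerMeasure) _ hWc (U x) (hU x).1 (hU x).2,
    integral_map hm.aemeasurable hfc.aestronglyMeasurable]
  exact hgU x

end Summit.QuantumFields.YangMills.Theorems.ColdStartUniversality

end
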